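import Mathlib

/-!
# Dimock's Cauchy difference formula and "the analyticity implies Lipschitz continuity" in the parameters of
# a renormalization-group step — kernel form with explicit constants

**Citation header (reproduction of PUBLISHED work; template file of the Bałaban lattice Yang–Mills cell `pub-balaban`,
TEMPLATE.md §16.7 "Coupling/parameter dependence of the one-step output — the template's printed mechanism for T4-DAG
NE9"; companion of `Dimock2011to13/*`, `DimockYuan2024/*`).**  Sources (TeX line numbers of the arXiv sources, read by
this seat): [Dimock2015] J. Dimock, *Ultraviolet regularity for QED in d = 3*, arXiv:1512.04373 (`QEDUV2revised.tex`),
Sect. 7 "The flow", proof of Lemma 25 (the contraction estimate for the map T), ll. 5647–5679; [Dimock2015ScalarQED3] J. Dimock, *Nonperturbative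
renormalization of scalar QED in d = 3*, J. Math. Phys. 56 (2015) 102304 = arXiv:1502.02946 (`scalarQED22.tex`),
Sect. 8 "The flow", proof of Lemma 40, ll. 5753–5777; [DimockYuan2024GNFlow] J. Dimock, C. Yuan, *Structural stability of the RG flow in the Gross–Neveu
model*, AHP 25 (2024) = arXiv:2303.07916v3, proof of Cor. 1 ll. 3222–3224 and proof of Thm. 4 ll. 4073–4076.  Folklore
background (Cauchy inequalities for Banach-valued holomorphic maps; Lipschitz property from a derivative bound):
[Chae1985Holomorphy] Thm 9.16 (PDF p. 77), Exercise 6B (PDF p. 50), Sect. 13 (PDF p. 99); Mathlib's Cauchy integral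
formula `DifferentiableOn.circleIntegral_sub_inv_smul` and Schwarz lemma `Complex.dist_le_div_mul_dist_of_mapsTo_ball`.
Dimock's papers are TEMPLATE LITERATURE for the cell (printed and proved mechanisms for HIS models), not manuscripts
under audit, and nothing here is evidence about any step of Bałaban's papers.

**What Dimock prints (verbatim, TeX → Unicode).**  [Dimock2015] ll. 5647–5658: *"Now E^*_k(m,E) is actually an
analytic function of its arguments so for the first term in (slippery2) we can write for r > 1
E_{k−1}^*(m_{1,k−1}, E_{1,k−1}) − E_{k−1}^*(m_{2,k−1}, E_{1,k−1}) = (1/2πi) ∫_{|t|=r} dt/(t(t−1)) E^*_{k−1}(m_{2,k−1} +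
t(m_{1,k−1} − m_{2,k−1}), E_{1,k−1}).  We can assume m_{1,k−1} ≠ m_{2,k−1} and take r = 3e_{k−1}^{3/4−8ε}|m_{1,k−1} −
m_{2,k−1}|^{−1}.  This is greater than one since |m_{1,k−1} − m_{2,k−1}| ≤ e_{k−1}^{3/4−8ε}‖ξ̲_1 − ξ̲_2‖ ≤
2e_{k−1}^{3/4−8ε}.  Also it keeps us well inside the domain for E^*_{k−1} as given by the main theorem.  Hence we can
use the estimate ‖E^*_{k−1}‖_k ≤ e_{k−1}^{1/4−6ε} from (tingle2).  Hence the first term in (slippery2) is bounded by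
𝒪(1)e_k^{−1/4+7ε}[e_{k−1}^{−3/4+8ε}|m_{1,k−1} − m_{2,k−1}|]e_{k−1}^{1/4−6ε} ≤ 𝒪(1)e_k^{ε}‖ξ̲_1 − ξ̲_2‖ ≤ (1/6)‖ξ̲_1 − ξ̲_2‖"* (ξ̲ = the underlined sequence variable ξ of Lemma 25)
(and identically in the second argument, ll. 5664–5679, with r = 3e_{k−1}^{1/4−7ε}‖E_{1,k−1} − E_{2,k−1}‖^{−1}_{k−1}).
[Dimock2015ScalarQED3] ll. 5753–5777: *"For the last term we use the fact that μ_k^*(μ_k, E_k) is actually an analytic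
function of μ_k, E_k on its domain |μ_k| ≤ λ_k^{1/2} and ‖E_k‖_{k,κ} ≤ 1. … For the first term we write for r > 1
μ^*_k(μ_{1,k}, E_{1,k}) − μ^*_k(μ_{2,k}, E_{1,k}) = (1/2πi) ∫_{|t|=r} dt/(t(t−1)) μ^*_k(μ_{2,k} + t(μ_{1,k} − μ_{2,k}),
E_{1,k}).  We use the bound |μ^*| ≤ 𝒪(1)λ_k^{7/12−11ε} on its domain of analyticity.  We take r = 4λ_k^{1/2+β}|μ_{1,k} −
μ_{2,k}|^{−1}.  This keeps us in the domain of analyticity and is greater than one since |μ_{1,k} − μ_{2,k}| ≤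
λ_k^{1/2+β}‖ξ_1 − ξ_2‖ ≤ 2λ_k^{1/2+β}.  Hence this term is bounded by 𝒪(1)(λ_k^{−1/2−β}|μ_{1,k} − μ_{2,k}|)λ_k^{7/12−11ε}"*.
[DimockYuan2024GNFlow] ll. 3222–3224: *"E_k^* is an analytic function of E_k in the full domain ‖E_k‖_{h,Γ₄} ≤ C_E g_k³.
Indeed in the sequence of maps E_k → W_k → W_k^# → E_k^# in lemma [Flem], the maps W_k → W_k^# is analytic by the
remarks following theorem [nahnah1].  The other steps are linear and hence analytic."*; ll. 4073–4076 (the MARGINAL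
coupling g_k is a coordinate of x_k = (E_k, g_k, z_k, p_k, v_k), l. 4035): *"For the Lipschitz continuity recall that in
the proof of corollary [cor] we observed that E_k^* is analytic in x_k. … we have that F_k(t,x_k) is analytic and
F(t,x_k) is analytic since every entry is analytic.  The analyticity implies Lipschitz continuity in x_k and it is
uniform in t which suffices for the existence theorem."*

**What this file PROVES (kernel, Mathlib only; `F` a complex Banach space of values, `E` any complex normed space of
parameters; explicit constants).**
* §1 `circleIntegral_difference_formula` / `difference_formula`: for `f : ℂ → F` complex differentiable on the closed
  disc `|t| ≤ r`, `r > 1`:  `∮_{|t|=r} (t(t−1))⁻¹ f(t) dt = 2πi (f 1 − f 0)` — Dimock's display, from Cauchy's integral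
  formula at the interior points `1` and `0` and `1/(t(t−1)) = 1/(t−1) − 1/t`.
* §2 `norm_sub_le_div_of_bound_sphere`: if `‖f‖ ≤ M` on `|t| = r` then `‖f 1 − f 0‖ ≤ M/(r − 1)` (integrand
  `≤ M/(r(r−1))` on a circle of length `2πr`).  This is Dimock's *"Hence … is bounded by 𝒪(1)[ϱ⁻¹|Δ|]·(sup bound)"*:
  with his `r = cϱ/|Δ|` (`c = 3` resp. `4`, `ϱ` = the radius scale of the analyticity domain, `|Δ|` the parameter
  difference) and his `|Δ| ≤ 2ϱ`, one has `r ≥ 3/2` resp. `r ≥ 2` and `M/(r − 1) ≤ (1 − 1/r)⁻¹·M/r ≤ (3/c resp. 2/c)·ϱ⁻¹|Δ|·M`.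
* §3 the Lipschitz consequences for `g : E → F` complex differentiable on `D ⊆ E` with `‖g‖ ≤ M` on `D`:
  `norm_sub_le_of_closedBall_subset` (closed `ϱ`-ball about `y` inside `D`, `‖x − y‖ < ϱ` ⇒
  `‖g x − g y‖ ≤ M‖x − y‖/(ϱ − ‖x − y‖)`, the slice `t ↦ g(y + t(x − y))` with `r = ϱ/‖x − y‖`),
  `norm_sub_le_of_closedBall_subset_half` (`‖x − y‖ ≤ ϱ/2` ⇒ `≤ (2M/ϱ)‖x − y‖`), `norm_sub_le_of_margin` /
  `lipschitzOnWith_of_margin` (any set `S` whose closed `ϱ`-neighbourhoods lie in `D`: `‖g x − g y‖ ≤ (4M/ϱ)‖x − y‖`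
  on `S`; separations `> ϱ/2` by the trivial bound `2M`), and for comparison `norm_sub_centre_le` (Schwarz form at the
  centre of an open ball, `2M/R`, no completeness needed).
* §4 real couplings: `real_param_lipschitz` (one coupling in a segment `[a, b]` whose complex `ϱ`-discs lie in `D`:
  `‖g s − g t‖ ≤ (4M/ϱ)|s − t|`) and `real_params_lipschitz_sum` (`n` couplings in a box with sup-norm margin `ϱ` in
  `D ⊆ ℂⁿ`: JOINT bound `‖g s − g t‖ ≤ (4M/ϱ)Σ_i |s_i − t_i|`, i.e. the `Σ_i Λ_i|g_i − g′_i|` shape of a history modulus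
  with uniform `Λ_i = 4M/ϱ`).

**NOT COVERED / scope.**  Nothing here asserts that any functional of Bałaban's procedure IS analytic in the coupling
on a complex neighbourhood, let alone on a `g`-INDEPENDENT one: [Balaban1987RG1] p. 264 prints only *"(or analytic)"*
for β on `[0, γ]`, and [Balaban1988Convergent] (2.27)(ii)–(2.28) p. 259 print analyticity in the FIELDS `(U, J)` on
`U^c_j(X, α_{0,j}, α_{1,j})` with `g_j`-dependent radii — choosing the comparison domain is the cell's NE9-CUT
(`t4/T4-EST-U3.md` §4), not decided here.  Dimock's own uses are for HIS parameters (`m_k`, `E_k`, `μ_k`, `x_k`) in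
`d = 3` QED / GN₂.  No power counting, no norms `‖·‖_k`, no specific domain of any model is formalised.

**How the cell uses this (pointer, not a ruling).**  `Balaban1983to89/T4OutputRate.lean` types the printed-ingredient
shape `LipBackground` ("analytic in U on U^c_j + Cauchy on a shrunk domain ⇒ Lipschitz in U with constant C_U(g, j)
e^{−κd_j(X)}", GAPS G-t4-U3-2, *"The Cauchy step itself is NOT carried out here"*) and the NEW-estimate shape `NE9`
(joint Lipschitz in the preceding couplings with history moduli `Λ j i`); `T4CouplingMatching.HistLipschitz` is the
same shape for the β-functions (node U2).  THE CAUCHY STEP IS `norm_sub_le_of_margin`: with `g = E^{(j)}(X; ·)`,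
`D` = the analyticity domain, `M = E₀e^{−κd_j(X)}` ((0.25)/(1.18)) and `ϱ` = the margin of the comparison set inside `D`,
the constant is `C = 4E₀e^{−κd_j(X)}/ϱ` — of the order `E₀/α_{·,j}` recorded in G-t4-U3-2 when `ϱ` is a fixed fraction
of the (2.28) radius; `real_params_lipschitz_sum` is the kernel form of D10's "Lipschitz in the whole variable x_k at
once" for finitely many real couplings.  What remains NEW is the analyticity-with-margin input itself (NE9-CUT) and any
DECAY of the moduli in `j − i` (fading memory; not a consequence of analyticity).  No `def … : Prop` is introduced
(D-0026).  Value = kernel form of a printed template mechanism with explicit constants, NOT summit progress.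

**Revision log.**  v1.1 (docstring-only; cross-read pv01-g5, GAPS C-pv01-20): three TeX line locators corrected —
D6 second-argument passage ll. 5664–5679 (was 5659–5670; (greenie2) is ll. 5676–5679), D5 passage ll. 5753–5777 (was
5753–5769; the quoted bound is ll. 5773–5777), D10 `x_k` sentence l. 4035 (was 4032).  No declaration changed.
-/

noncomputable section

open Complex Metric Set

namespace Literature.MathematicalPhysics.QuantumFieldTheory.Dimock2015

variable {E F : Type*} [NormedAddCommGroup E] [NormedSpace ℂ E] [NormedAddCommGroup F] [NormedSpace ℂ F]

/-! ## §1  Dimock's Cauchy difference formula `f(1) − f(0) = (2πi)⁻¹ ∮_{|t|=r} f(t) dt/(t(t−1))` -/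

/-- The integrand `(t(t−1))⁻¹ • f t` of the difference formula splits as `(t−1)⁻¹ • f t − t⁻¹ • f t` off `{0, 1}`.
[folklore] -/
theorem inv_mul_sub_one_smul {t : ℂ} (h0 : t ≠ 0) (h1 : t ≠ 1) (v : F) :
    (t * (t - 1))⁻¹ • v = (t - 1)⁻¹ • v - t⁻¹ • v := by
  have h1' : t - 1 ≠ 0 := sub_ne_zero.2 h1
  rw [← sub_smul]
  congr 1
  field_simp
  ring

/-- On the circle `|t| = r`, `r > 1`, the points `0` and `1` are avoided: `t ≠ 0`. [folklore] -/
theorem ne_zero_of_mem_sphere {t : ℂ} {r : ℝ} (hr : 1 < r) (ht : t ∈ sphere (0 : ℂ) r) : t ≠ 0 := by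
  intro h
  rw [mem_sphere, dist_zero_right, h, norm_zero] at ht
  linarith

/-- On the circle `|t| = r`, `r > 1`: `t ≠ 1`. [folklore] -/
theorem ne_one_of_mem_sphere {t : ℂ} {r : ℝ} (hr : 1 < r) (ht : t ∈ sphere (0 : ℂ) r) : t ≠ 1 := by
  intro h
  rw [mem_sphere, dist_zero_right, h, norm_one] at ht
  linarith

/-- On the circle `|t| = r`, `r > 1`: `r − 1 ≤ ‖t − 1‖`. [folklore] -/
theorem sub_one_le_norm_sub_one {t : ℂ} {r : ℝ} (ht : t ∈ sphere (0 : ℂ) r) : r - 1 ≤ ‖t - 1‖ := by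
  rw [mem_sphere, dist_zero_right] at ht
  have := norm_sub_norm_le t 1
  rw [norm_one, ht] at this
  linarith [abs_le.1 (abs_norm_sub_norm_le t 1)]

/-- Circle integrability of `(t − w)⁻¹ • f t` on `|t| = r` for `f` differentiable on the closed disc and `‖w‖ ≠ r`.
[folklore] -/
theorem circleIntegrable_sub_inv_smul {f : ℂ → F} {r : ℝ} {w : ℂ} (hr : 0 ≤ r)
    (hf : DifferentiableOn ℂ f (closedBall 0 r)) (hw : ‖w‖ ≠ r) :
    CircleIntegrable (fun t => (t - w)⁻¹ • f t) 0 r := by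
  refine ContinuousOn.circleIntegrable hr ?_
  refine ContinuousOn.smul ?_ (hf.continuousOn.mono sphere_subset_closedBall)
  refine ContinuousOn.inv₀ (by fun_prop) ?_
  intro t ht h
  rw [mem_sphere, dist_zero_right] at ht
  exact hw (by rw [← sub_eq_zero.1 h, ht])

/-- **Dimock's Cauchy difference formula** ([Dimock2015], arXiv TeX L5647–5651; [Dimock2015ScalarQED3] ll. 5762–5769): for
`f` complex differentiable on the closed disc `|t| ≤ r`, `r > 1`, with values in a complex Banach space,
`∮_{|t|=r} f(t) dt/(t(t−1)) = 2πi (f(1) − f(0))` — Cauchy's integral formula at the two interior points `1` and `0`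
(Mathlib `DifferentiableOn.circleIntegral_sub_inv_smul`) and `1/(t(t−1)) = 1/(t−1) − 1/t`.
[cite: Dimock2015, Sect. 7 proof of Lemma 25 (arXiv:1512.04373 TeX ll. 5647–5651)] -/
theorem circleIntegral_difference_formula [CompleteSpace F] {f : ℂ → F} {r : ℝ} (hr : 1 < r)
    (hf : DifferentiableOn ℂ f (closedBall 0 r)) :
    (∮ t in C(0, r), (t * (t - 1))⁻¹ • f t) = (2 * Real.pi * I : ℂ) • (f 1 - f 0) := by
  have hr0 : 0 ≤ r := by linarith
  have h1 : (1 : ℂ) ∈ ball (0 : ℂ) r := by simp [mem_ball, hr]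
  have h0 : (0 : ℂ) ∈ ball (0 : ℂ) r := mem_ball_self (by linarith)
  have hI1 := hf.circleIntegral_sub_inv_smul h1
  have hI0 := hf.circleIntegral_sub_inv_smul h0
  have hci1 : CircleIntegrable (fun t => (t - 1)⁻¹ • f t) 0 r :=
    circleIntegrable_sub_inv_smul hr0 hf (by rw [norm_one]; exact hr.ne)
  have hci0 : CircleIntegrable (fun t => (t - 0)⁻¹ • f t) 0 r :=
    circleIntegrable_sub_inv_smul hr0 hf (by rw [norm_zero]; exact (zero_lt_one.trans hr).ne)
  calc (∮ t in C(0, r), (t * (t - 1))⁻¹ • f t)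
      = ∮ t in C(0, r), ((t - 1)⁻¹ • f t - (t - 0)⁻¹ • f t) := by
        refine circleIntegral.integral_congr hr0 fun t ht => ?_
        simp only [sub_zero]
        exact inv_mul_sub_one_smul (ne_zero_of_mem_sphere hr ht) (ne_one_of_mem_sphere hr ht) (f t)
    _ = (∮ t in C(0, r), (t - 1)⁻¹ • f t) - ∮ t in C(0, r), (t - 0)⁻¹ • f t :=
        circleIntegral.integral_sub hci1 hci0
    _ = (2 * Real.pi * I : ℂ) • (f 1 - f 0) := by rw [hI1, hI0, smul_sub]

/-- The difference formula solved for `f 1 − f 0` (the form Dimock prints: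
`E*(m₁,E) − E*(m₂,E) = (1/2πi)∮_{|t|=r} dt/(t(t−1)) E*(m₂ + t(m₁ − m₂), E)`).
[cite: Dimock2015, Sect. 7 proof of Lemma 25 (arXiv:1512.04373 TeX ll. 5647–5651)] -/
theorem difference_formula [CompleteSpace F] {f : ℂ → F} {r : ℝ} (hr : 1 < r)
    (hf : DifferentiableOn ℂ f (closedBall 0 r)) :
    f 1 - f 0 = (2 * Real.pi * I : ℂ)⁻¹ • ∮ t in C(0, r), (t * (t - 1))⁻¹ • f t := by
  rw [circleIntegral_difference_formula hr hf, inv_smul_smul₀]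
  simp [Real.pi_ne_zero, I_ne_zero]

/-! ## §2  The Cauchy bound `‖f(1) − f(0)‖ ≤ sup_{|t|=r}‖f‖ / (r − 1)` -/

/-- **The bound Dimock draws from the difference formula** (*"Hence … is bounded by"* (greenie1)/(greenie2) of
[Dimock2015], ll. 5659–5679): if `‖f t‖ ≤ M` on the circle `|t| = r`, `r > 1`, then `‖f 1 − f 0‖ ≤ M/(r − 1)`:
the integrand has norm `≤ M/(r(r−1))` on the circle of length `2πr`.
[cite: Dimock2015, Sect. 7 proof of Lemma 25 (arXiv:1512.04373 TeX ll. 5647–5679)] -/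
theorem norm_sub_le_div_of_bound_sphere [CompleteSpace F] {f : ℂ → F} {r M : ℝ} (hr : 1 < r)
    (hf : DifferentiableOn ℂ f (closedBall 0 r)) (hM : ∀ t ∈ sphere (0 : ℂ) r, ‖f t‖ ≤ M) :
    ‖f 1 - f 0‖ ≤ M / (r - 1) := by
  have hr0 : 0 < r := by linarith
  have hr1 : 0 < r - 1 := by linarith
  have hbound : ∀ t ∈ sphere (0 : ℂ) r, ‖(t * (t - 1))⁻¹ • f t‖ ≤ M / (r * (r - 1)) := by
    intro t ht
    have htn : ‖t‖ = r := by rwa [mem_sphere, dist_zero_right] at ht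
    have ht1 : r - 1 ≤ ‖t - 1‖ := sub_one_le_norm_sub_one ht
    have hM0 : 0 ≤ M := (norm_nonneg _).trans (hM t ht)
    rw [norm_smul, norm_inv, norm_mul, htn]
    calc (r * ‖t - 1‖)⁻¹ * ‖f t‖ ≤ (r * (r - 1))⁻¹ * M := by
          apply mul_le_mul _ (hM t ht) (norm_nonneg _) (by positivity)
          exact inv_anti₀ (by positivity) (mul_le_mul_of_nonneg_left ht1 hr0.le)
      _ = M / (r * (r - 1)) := by rw [inv_mul_eq_div]
  have hint := circleIntegral.norm_integral_le_of_norm_le_const hr0.le hbound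
  rw [difference_formula hr hf, norm_smul, norm_inv]
  have h2pi : ‖(2 * Real.pi * I : ℂ)‖ = 2 * Real.pi := by
    simp [Real.pi_pos.le]
  rw [h2pi]
  calc (2 * Real.pi)⁻¹ * ‖∮ t in C(0, r), (t * (t - 1))⁻¹ • f t‖
      ≤ (2 * Real.pi)⁻¹ * (2 * Real.pi * r * (M / (r * (r - 1)))) :=
        mul_le_mul_of_nonneg_left hint (by positivity)
    _ = M / (r - 1) := by
        field_simp

/-! ## §3  Lipschitz dependence from analyticity on a complex ball (any complex normed parameter space) -/

/-- The complex line through `y` in direction `u`, `t ↦ y + t • u`, maps the closed disc `|t| ≤ ϱ/‖u‖` into the closed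
ball `closedBall y ϱ` (`u ≠ 0`). [folklore] -/
theorem lineMap_mem_closedBall {y u : E} {ϱ : ℝ} (hu : u ≠ 0) {t : ℂ} (ht : t ∈ closedBall (0 : ℂ) (ϱ / ‖u‖)) :
    y + t • u ∈ closedBall y ϱ := by
  have hu' : 0 < ‖u‖ := norm_pos_iff.2 hu
  rw [mem_closedBall, dist_zero_right] at ht
  rw [mem_closedBall, dist_eq_norm, add_sub_cancel_left, norm_smul]
  calc ‖t‖ * ‖u‖ ≤ ϱ / ‖u‖ * ‖u‖ := mul_le_mul_of_nonneg_right ht hu'.le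
    _ = ϱ := div_mul_cancel₀ ϱ hu'.ne'

/-- **Analytic ⇒ Lipschitz, sharp local form** (the use Dimock makes of the difference formula, [Dimock2015] L5647–5656,
[Dimock2015ScalarQED3] ll. 5753–5777, [DimockYuan2024GNFlow] proof of Thm 4 L4073–4076 *"The analyticity implies Lipschitz
continuity in x_k"*): let `g : E → F` be complex differentiable on `D ⊆ E` (a complex normed space of parameters) with
`‖g‖ ≤ M` on `D`, and let the closed ball of radius `ϱ` about `y` lie in `D`.  Then for `‖x − y‖ < ϱ`,
`‖g x − g y‖ ≤ M‖x − y‖/(ϱ − ‖x − y‖)` — Dimock's `M/(r − 1)` with `r = ϱ/‖x − y‖` applied to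
`t ↦ g(y + t(x − y))`. [cite: Dimock2015, Sect. 7 proof of Lemma 25 (arXiv:1512.04373 TeX ll. 5647–5656)] -/
theorem norm_sub_le_of_closedBall_subset [CompleteSpace F] {g : E → F} {D : Set E} {x y : E} {ϱ M : ℝ}
    (hg : DifferentiableOn ℂ g D) (hM : ∀ z ∈ D, ‖g z‖ ≤ M) (hy : closedBall y ϱ ⊆ D) (hxy : ‖x - y‖ < ϱ) :
    ‖g x - g y‖ ≤ M * ‖x - y‖ / (ϱ - ‖x - y‖) := by
  have hϱ : 0 < ϱ := (norm_nonneg _).trans_lt hxy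
  have hyD : y ∈ D := hy (mem_closedBall_self hϱ.le)
  have hM0 : 0 ≤ M := (norm_nonneg _).trans (hM y hyD)
  by_cases hu : x - y = 0
  · have : x = y := sub_eq_zero.1 hu
    subst this
    simp only [sub_self, norm_zero, mul_zero, zero_div, le_refl]
  set u := x - y with hu_def
  have hu' : 0 < ‖u‖ := norm_pos_iff.2 hu
  set r := ϱ / ‖u‖ with hr_def
  have hr : 1 < r := by rw [hr_def, lt_div_iff₀ hu', one_mul]; exact hxy
  -- the slice `f t = g (y + t • u)`
  set f : ℂ → F := fun t => g (y + t • u) with hf_def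
  have hmaps : MapsTo (fun t : ℂ => y + t • u) (closedBall (0 : ℂ) r) D := fun t ht =>
    hy (lineMap_mem_closedBall hu ht)
  have hf : DifferentiableOn ℂ f (closedBall 0 r) := by
    refine hg.comp ?_ hmaps
    fun_prop
  have hfM : ∀ t ∈ sphere (0 : ℂ) r, ‖f t‖ ≤ M := fun t ht => hM _ (hmaps (sphere_subset_closedBall ht))
  have h := norm_sub_le_div_of_bound_sphere hr hf hfM
  have hf1 : f 1 = g x := by simp [hf_def, hu_def]
  have hf0 : f 0 = g y := by simp [hf_def]
  rw [hf1, hf0] at h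
  calc ‖g x - g y‖ ≤ M / (r - 1) := h
    _ = M * ‖u‖ / (ϱ - ‖u‖) := by
        rw [hr_def]
        have hne : ϱ - ‖u‖ ≠ 0 := (sub_pos.2 hxy).ne'
        field_simp

/-- **Analytic ⇒ Lipschitz at separations `≤ ϱ/2`**: under the hypotheses of `norm_sub_le_of_closedBall_subset`, for
`‖x − y‖ ≤ ϱ/2` one has `‖g x − g y‖ ≤ (2M/ϱ)‖x − y‖` (Dimock's regime: his radius `r` is `≥ 3/2`, so his `𝒪(1)` is
`(1 − 1/r)⁻¹ ≤ 3`; here `r ≥ 2` and the constant is `2`). [cite: Dimock2015, Sect. 7 proof of Lemma 25 (arXiv:1512.04373 TeX ll. 5647–5656)] -/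
theorem norm_sub_le_of_closedBall_subset_half [CompleteSpace F] {g : E → F} {D : Set E} {x y : E} {ϱ M : ℝ}
    (hϱ : 0 < ϱ) (hg : DifferentiableOn ℂ g D) (hM : ∀ z ∈ D, ‖g z‖ ≤ M) (hy : closedBall y ϱ ⊆ D)
    (hxy : ‖x - y‖ ≤ ϱ / 2) :
    ‖g x - g y‖ ≤ 2 * M / ϱ * ‖x - y‖ := by
  have hyD : y ∈ D := hy (mem_closedBall_self hϱ.le)
  have hM0 : 0 ≤ M := (norm_nonneg _).trans (hM y hyD)
  have hlt : ‖x - y‖ < ϱ := by linarith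
  have h := norm_sub_le_of_closedBall_subset hg hM hy hlt
  have hden : ϱ / 2 ≤ ϱ - ‖x - y‖ := by linarith
  calc ‖g x - g y‖ ≤ M * ‖x - y‖ / (ϱ - ‖x - y‖) := h
    _ ≤ M * ‖x - y‖ / (ϱ / 2) :=
        div_le_div_of_nonneg_left (by positivity) (by positivity) hden
    _ = 2 * M / ϱ * ‖x - y‖ := by field_simp

/-- **Analytic ⇒ Lipschitz on a set with a margin** (the shape the consumers use: `S` = the comparison set of
parameters/backgrounds, `ϱ` = its margin inside the analyticity domain `D`, `M` = the sup bound there): if every closed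
`ϱ`-ball about a point of `S` lies in `D`, `g` is complex differentiable on `D` and `‖g‖ ≤ M` on `D`, then
`‖g x − g y‖ ≤ (4M/ϱ)‖x − y‖` for all `x, y ∈ S` (separations `≤ ϱ/2` by the Cauchy bound with constant `2M/ϱ`,
larger ones by the trivial bound `2M`). [cite: DimockYuan2024GNFlow, proof of Thm 4 (arXiv:2303.07916v3 TeX ll. 4073–4076)] -/
theorem norm_sub_le_of_margin [CompleteSpace F] {g : E → F} {D S : Set E} {ϱ M : ℝ} (hϱ : 0 < ϱ)
    (hg : DifferentiableOn ℂ g D) (hM : ∀ z ∈ D, ‖g z‖ ≤ M) (hS : ∀ y ∈ S, closedBall y ϱ ⊆ D)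
    {x y : E} (hx : x ∈ S) (hy : y ∈ S) :
    ‖g x - g y‖ ≤ 4 * M / ϱ * ‖x - y‖ := by
  have hxD : x ∈ D := hS x hx (mem_closedBall_self hϱ.le)
  have hyD : y ∈ D := hS y hy (mem_closedBall_self hϱ.le)
  have hM0 : 0 ≤ M := (norm_nonneg _).trans (hM y hyD)
  rcases le_or_gt ‖x - y‖ (ϱ / 2) with hle | hgt
  · calc ‖g x - g y‖ ≤ 2 * M / ϱ * ‖x - y‖ := norm_sub_le_of_closedBall_subset_half hϱ hg hM (hS y hy) hle
      _ ≤ 4 * M / ϱ * ‖x - y‖ := by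
          apply mul_le_mul_of_nonneg_right _ (norm_nonneg _)
          exact div_le_div_of_nonneg_right (by linarith) hϱ.le
  · calc ‖g x - g y‖ ≤ ‖g x‖ + ‖g y‖ := norm_sub_le _ _
      _ ≤ M + M := add_le_add (hM x hxD) (hM y hyD)
      _ = 4 * M / ϱ * (ϱ / 2) := by field_simp; ring
      _ ≤ 4 * M / ϱ * ‖x - y‖ := mul_le_mul_of_nonneg_left hgt.le (by positivity)

/-- The same, packaged as `LipschitzOnWith` with constant `(4M/ϱ).toNNReal`.
[cite: DimockYuan2024GNFlow, proof of Thm 4 (arXiv:2303.07916v3 TeX ll. 4073–4076)] -/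
theorem lipschitzOnWith_of_margin [CompleteSpace F] {g : E → F} {D S : Set E} {ϱ M : ℝ} (hϱ : 0 < ϱ)
    (hg : DifferentiableOn ℂ g D) (hM : ∀ z ∈ D, ‖g z‖ ≤ M) (hS : ∀ y ∈ S, closedBall y ϱ ⊆ D) :
    LipschitzOnWith (4 * M / ϱ).toNNReal g S := by
  refine LipschitzOnWith.of_dist_le_mul fun x hx y hy => ?_
  rw [dist_eq_norm, dist_eq_norm]
  have h := norm_sub_le_of_margin hϱ hg hM hS hx hy
  have hM0 : 0 ≤ M := by
    have hyD : y ∈ D := hS y hy (mem_closedBall_self hϱ.le)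
    exact (norm_nonneg _).trans (hM y hyD)
  rwa [Real.coe_toNNReal _ (by positivity)]

/-- **At the centre** (the Schwarz-lemma form, for comparison; Mathlib `Complex.dist_le_div_mul_dist_of_mapsTo_ball`
gives it on the OPEN ball without completeness of `F`): `g` differentiable on `ball c R` with `‖g‖ ≤ M` there ⇒
`‖g x − g c‖ ≤ (2M/R)‖x − c‖` for `x ∈ ball c R`. [folklore] -/
theorem norm_sub_centre_le {g : E → F} {c x : E} {R M : ℝ} (hg : DifferentiableOn ℂ g (ball c R))
    (hM : ∀ z ∈ ball c R, ‖g z‖ ≤ M) (hx : x ∈ ball c R) :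
    ‖g x - g c‖ ≤ 2 * M / R * ‖x - c‖ := by
  have hR : 0 < R := dist_nonneg.trans_lt (mem_ball.1 hx) |>.trans_le' le_rfl
  have hmaps : MapsTo g (ball c R) (closedBall (g c) (2 * M)) := fun w hw => by
    rw [mem_closedBall, dist_eq_norm]
    calc ‖g w - g c‖ ≤ ‖g w‖ + ‖g c‖ := norm_sub_le _ _
      _ ≤ M + M := add_le_add (hM w hw) (hM c (mem_ball_self hR))
      _ = 2 * M := by ring
  have h := Complex.dist_le_div_mul_dist_of_mapsTo_ball hg hmaps hx
  rwa [dist_eq_norm, dist_eq_norm] at h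

/-! ## §4  Real parameters (couplings): one coupling in a segment, finitely many couplings in a box -/

/-- **One real coupling** (B12 p. 264 *"(or analytic)"* on `[0, γ]`; D10's coordinates of `x_k`): if `g : ℂ → F` is
complex differentiable on `D` with `‖g‖ ≤ M` there and `D` contains the closed `ϱ`-discs about every point of the real
segment `[a, b]`, then `‖g s − g t‖ ≤ (4M/ϱ)|s − t|` for all `s, t ∈ [a, b]` — a Lipschitz modulus in the coupling from
analyticity and a sup bound alone. [cite: DimockYuan2024GNFlow, proof of Thm 4 (arXiv:2303.07916v3 TeX ll. 4073–4076)] -/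
theorem real_param_lipschitz [CompleteSpace F] {g : ℂ → F} {D : Set ℂ} {a b ϱ M : ℝ} (hϱ : 0 < ϱ)
    (hg : DifferentiableOn ℂ g D) (hM : ∀ z ∈ D, ‖g z‖ ≤ M)
    (hD : ∀ s ∈ Icc a b, closedBall (s : ℂ) ϱ ⊆ D) {s t : ℝ} (hs : s ∈ Icc a b) (ht : t ∈ Icc a b) :
    ‖g s - g t‖ ≤ 4 * M / ϱ * |s - t| := by
  have hS : ∀ y ∈ ((↑) : ℝ → ℂ) '' Icc a b, closedBall y ϱ ⊆ D := by
    rintro _ ⟨s', hs', rfl⟩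
    exact hD s' hs'
  have h := norm_sub_le_of_margin hϱ hg hM hS (mem_image_of_mem _ hs) (mem_image_of_mem _ ht)
  rwa [← ofReal_sub, norm_real, Real.norm_eq_abs] at h

/-- **Finitely many real couplings** `(g₀, …, g_{n−1})` in a box with margin `ϱ` inside the joint analyticity domain
`D ⊆ ℂⁿ` (sup norm): JOINT Lipschitz bound `‖g s − g t‖ ≤ (4M/ϱ)·max_i |s_i − t_i| ≤ (4M/ϱ)·Σ_i |s_i − t_i|` — the
`Σ_i Λ_i |g_i − g′_i|` shape of a history-Lipschitz modulus with the UNIFORM moduli `Λ_i = 4M/ϱ` (D10 Thm 4: Lipschitz in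
the whole variable `x_k` at once from joint analyticity). [cite: DimockYuan2024GNFlow, proof of Thm 4 (arXiv:2303.07916v3 TeX ll. 4035, 4073–4076)] -/
theorem real_params_lipschitz_sum [CompleteSpace F] {n : ℕ} {g : (Fin n → ℂ) → F} {D : Set (Fin n → ℂ)}
    {B : Set (Fin n → ℝ)} {ϱ M : ℝ} (hϱ : 0 < ϱ) (hg : DifferentiableOn ℂ g D) (hM : ∀ z ∈ D, ‖g z‖ ≤ M)
    (hD : ∀ s ∈ B, closedBall (fun i => (s i : ℂ)) ϱ ⊆ D) {s t : Fin n → ℝ} (hs : s ∈ B) (ht : t ∈ B) :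
    ‖g (fun i => (s i : ℂ)) - g (fun i => (t i : ℂ))‖ ≤ 4 * M / ϱ * ∑ i, |s i - t i| := by
  have hS : ∀ y ∈ (fun s : Fin n → ℝ => fun i => (s i : ℂ)) '' B, closedBall y ϱ ⊆ D := by
    rintro _ ⟨s', hs', rfl⟩
    exact hD s' hs'
  have h := norm_sub_le_of_margin hϱ hg hM hS (mem_image_of_mem _ hs) (mem_image_of_mem _ ht)
  have hsD : (fun i => (s i : ℂ)) ∈ D := hD s hs (mem_closedBall_self hϱ.le)
  have hM0 : 0 ≤ M := (norm_nonneg _).trans (hM _ hsD)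
  refine h.trans (mul_le_mul_of_nonneg_left ?_ (by positivity))
  -- sup norm ≤ sum of the coordinate distances
  refine (pi_norm_le_iff_of_nonneg (Finset.sum_nonneg fun i _ => abs_nonneg _)).2 fun i => ?_
  rw [Pi.sub_apply, ← ofReal_sub, norm_real, Real.norm_eq_abs]
  exact Finset.single_le_sum (f := fun j => |s j - t j|) (fun j _ => abs_nonneg _) (Finset.mem_univ i)

end Literature.MathematicalPhysics.QuantumFieldTheory.Dimock2015

end
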